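import Summits.QuantumFields.BalabanUV.Beta.GAN24.DerivativeRateTransferLoewnerGramSchedule

/-!
# `BalabanUV.Beta.GAN24.DerivativeRateTransferLoewnerGramMismatch` — binder row G-an2-4 ∕ (CONV-C), route R6 «VALUES, NOT DERIVATIVES», PART 92:
# THE RESTRICTION LEG — THE TOWER's MINIMISER MISMATCH `Qf_jℋ_{j+1} − ℋ_j` IN ENERGY CURRENCY IS BOUNDED BY THE END's OWN DATA: R9°'s value squeeze
# `f(U_j) ≤ f(Q̄U_{j+1}) ≤ g(U_{j+1}) + δ^M ≤ g(ιU_j) + δ^M ≤ f(U_j) + δ^ι + δ^M` plus quadratic growth, in PART 20's matrix letters where it is EXACT —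
# quadratic growth constant `1` (Galerkin Pythagoras, PART 18's `energy_split`), `δ^M` = the (STAB) slack, `δ^ι` = (CONS): for every coarse vector `v`,
# `⟨Qfℋ′v − ℋv, H(Qfℋ′v − ℋv)⟩ = ⟨Qfℋ′v, HQfℋ′v⟩ − ⟨v,𝒮v⟩ ≤ (⟨v,𝒮′v⟩ − ⟨v,𝒮v⟩) + ε⟨v,𝒮′v⟩ + δ⟨v,ℋ′ᵀGℋ′v⟩`, at a unit source `≤ κ + εB + δN`, and
# along the tower `≤ C·θ^j` under PART 20's slacks or PART 88's scheduled family (unit b2b-balaban-gan24-p3, gen 47; v1 — the averaged-minimiser mismatch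
# of gan24-idea-1 LENS 19 ∕ 20 ∕ 21 and of the «R9° notes», typed on the lineage's shapes: it is NOT an independent input in ENERGY currency)

NOT IN PRINT; OUR PROOF (for the ROUTE; [folklore] — PART 18's `energy_split` ∕ `mulVec_minOp` ∕ `effForm_step_diag_le_cons` ∕ `dotProduct_effForm_eq_energy` and
PART 88's `mulSlack_le` ∕ `addSlack_le` BY NAME).  HONEST FRAMING (cell contract, verbatim): «discharging `BetaPertH` makes Bałaban's UV stability UNCONDITIONAL — a
real constructive-QFT result; it is NOT the continuum limit and NOT the Clay problem.»  HONEST DEPENDENCY (verbatim): «continuum YM on T⁴ ⇐ BetaPertH ∧ nine spine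
estimates (0/9 proved); BetaPertH ⇐ (D1) ∧ (D4) ∧ CAP+tail; G-an2-4 gates asym, D1 and NE2/3/4.»

WHY THIS FILE.  PART 17 ∕ 18 ∕ 20 type the PROLONGATION leg `P_jℋ_je_y − ℋ_{j+1}e_y` in the FINE energy norm ((CONS) minus the effective-form step).  The
leg the «R9° notes» and LENS 19–21 reason about is the other one — the RESTRICTION leg `Qf_jℋ_{j+1}v − ℋ_jv` («coarse average of the finer minimiser
against the coarser minimiser»), measured by the COARSE form `H_j`.  Because `Qf_jℋ_{j+1}v` is admissible for the level-`j` problem (`Q_jQf_jℋ_{j+1}v =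
Q_{j+1}ℋ_{j+1}v = v`), Galerkin Pythagoras gives its `H_j`-energy EXACTLY as a trial-energy excess, which (STAB) bounds by `(1+ε)𝒮′ + δ·Gram − 𝒮` and
(CONS) closes at a unit source.  HONEST SHAPE: under PART 56 ∕ 88's family the additive slack `(1+s⁻¹)τ_j²·Gram` itself carries the link mismatch `τ_j`, so as a
DERIVATION of the mismatch schedule this is a bootstrap inequality (the mismatch re-enters its own bound at SECOND order), not a closed formula; in ENERGY currency
and GIVEN the END's data it is free — the sup ∕ RMS LINK letters of LENS 20 ∕ 21 (what PART 56's `hτ` consumes) are a different currency and stay consumer inputs.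

WHAT THIS FILE PROVES (0 sorry, 0 `def`, nothing cited):
* §1 `mismatch_admissible` (`Q(Qfℋ′v) = v`), **`mismatch_energy_eq`** (`⟨Qfℋ′v − ℋv, H(Qfℋ′v − ℋv)⟩ = ⟨Qfℋ′v, HQfℋ′v⟩ − ⟨v,𝒮v⟩`, `H` symmetric),
  **`mismatch_energy_le_of_stabGram`** (`≤ (1+ε)⟨v,𝒮′v⟩ + δ⟨v,(ℋ′ᵀGℋ′)v⟩ − ⟨v,𝒮v⟩` under (STAB-ε,δ)),
  **`mismatch_energy_le_of_stabGram_of_consForm`** (every datum `v`: `≤ ε⟨v,𝒮′v⟩ + δ⟨v,(ℋ′ᵀGℋ′)v⟩ + ⟨ℋv,(PᵀH′P − H)ℋv⟩` — the (CONS) FORM at `v`),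
  **`mismatch_energy_single_le_of_stabGram_of_cons`** (at `v = e_y`, with `Q′P = Q`, (CONS ≤ κ), `|𝒮′| ≤ B`, `|ℋ′ᵀGℋ′| ≤ N`, `0 ≤ ε, δ`: `≤ κ + εB + δN`).
  `mismatch_mem_ker`, **`mismatch_sq_le_of_coercive`** (coarse form coercive on `ker Q`, `Qz = 0 → γ⟨z,z⟩ ≤ ⟨z,Hz⟩`, `0 < γ` ⟹ `⟨m,m⟩ ≤ (κ + εB + δN)∕γ` —
  the squared-mismatch MASS letter of the «R9° notes» in the matrix currency).
* §2 **`mismatch_energy_step_rate_of_stabGram_of_cons`** (PART 20's tower letters: `≤ (cst + cε·B + cδ·N)·θ^j` for all `j, y`),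
  **`mismatch_energy_rate_of_stabFamily_of_schedules`** (PART 88's family + schedules + `hrate`: `≤ (cst + (1 + 2E₀)B + 2M₀²N₀Λ)·θ^j`).
WHAT IT DOES NOT DO: convert the `H_j`-energy of the mismatch into the sup ∕ RMS link letters `τ_j(e′)` (a coercivity ∕ Poincaré step on `ker Q_j` plus the
links-vs-fields dictionary — consumer side); discharge (STAB) ∕ (CONS); instantiate Bałaban's tower.  SUPPLIER work on route R6 (rank 2, REDUCTION, no seat); no
consumer of record; NEVER «G-an2-4 closed»; NOT (CONV-C), NOT D1, NOT `BetaPertH`, NOT continuum, NOT Clay.  Records: `HOME/b2b-balaban-gan24-p3/WOODBURY-FIBRE.md` v14.7.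
-/

noncomputable section

open Set Matrix

namespace Summit.QuantumFields.BalabanUV.Beta.GAN24.DerivativeRateTransferLoewnerGramMismatch

open Literature.MathematicalPhysics.QuantumFieldTheory.Balaban1983to89.Beta.Composition (kkt)
open Literature.MathematicalPhysics.QuantumFieldTheory.Balaban1983to89.Beta.CompositionSingular (effForm minOp)
open Summit.QuantumFields.BalabanUV.Beta.GAN24.DerivativeRateTransferLoewnerKKT (mulVec_dotProduct_eq energy_split mulVec_minOp
  effForm_step_diag_le_cons single_dotProduct_mulVec_single transpose_eq_of_posSemidef dotProduct_effForm_eq_energy dotProduct_effForm_le_trial)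
open Summit.QuantumFields.BalabanUV.Beta.GAN24.DerivativeRateTransferLoewnerGramSchedule (mulSlack_le addSlack_le)

/-! ## §1 Two levels: the restriction leg in the coarse energy norm -/

section TwoLevels

variable {c ν ν' : Type*} [Fintype c] [Fintype ν] [Fintype ν'] [DecidableEq c] [DecidableEq ν] [DecidableEq ν']
variable {H : Matrix ν ν ℝ} {Q : Matrix c ν ℝ} {H' : Matrix ν' ν' ℝ} {Q' : Matrix c ν' ℝ} {Qf : Matrix ν ν' ℝ} {P : Matrix ν' ν ℝ}
variable {G : Matrix ν' ν' ℝ} {ε δ : ℝ}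

omit [DecidableEq ν] in
/-- the coarse average of the finer minimiser is ADMISSIBLE for the coarser problem: `Q′ = Q·Qf` ⟹ `Q(Qfℋ′v) = v`. [folklore] -/
theorem mismatch_admissible (h' : IsUnit (kkt H' Q').det) (hcomp : Q' = Q * Qf) (v : c → ℝ) :
    Q *ᵥ (Qf *ᵥ (minOp H' Q' *ᵥ v)) = v := by
  rw [mulVec_mulVec, ← hcomp]; exact mulVec_minOp h' v

/-- **`mismatch_energy_eq` — GALERKIN PYTHAGORAS FOR THE RESTRICTION LEG** [folklore; PART 18's `energy_split` at the trial `Qfℋ′v`]: `H` symmetric, bordered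
matrices nonsingular, `Q′ = Q·Qf` ⟹ `⟨Qfℋ′v − ℋv, H(Qfℋ′v − ℋv)⟩ = ⟨Qfℋ′v, H·Qfℋ′v⟩ − ⟨v, 𝒮v⟩` (quadratic growth constant EXACTLY `1`). -/
theorem mismatch_energy_eq (hH : Hᵀ = H) (h : IsUnit (kkt H Q).det) (h' : IsUnit (kkt H' Q').det) (hcomp : Q' = Q * Qf) (v : c → ℝ) :
    (Qf *ᵥ (minOp H' Q' *ᵥ v) - minOp H Q *ᵥ v) ⬝ᵥ (H *ᵥ (Qf *ᵥ (minOp H' Q' *ᵥ v) - minOp H Q *ᵥ v)) =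
      (Qf *ᵥ (minOp H' Q' *ᵥ v)) ⬝ᵥ (H *ᵥ (Qf *ᵥ (minOp H' Q' *ᵥ v))) - v ⬝ᵥ (effForm H Q *ᵥ v) := by
  have hsplit := energy_split hH h (mismatch_admissible h' hcomp v)
  linarith

/-- **`mismatch_energy_le_of_stabGram` — THE SQUEEZE UNDER (STAB-ε,δ)** [our proof]: `H` PSD, `Q′ = Q·Qf`, `0 ≤ (1+ε)•H′ + δ•G − QfᵀHQf` ⟹ for every `v`,
`⟨Qfℋ′v − ℋv, H(Qfℋ′v − ℋv)⟩ ≤ (1+ε)·⟨v,𝒮′v⟩ + δ·⟨v,(ℋ′ᵀGℋ′)v⟩ − ⟨v,𝒮v⟩` — R9°'s `δ^M` is the (STAB) slack `ε⟨v,𝒮′v⟩ + δ⟨v,ℋ′ᵀGℋ′v⟩`. -/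
theorem mismatch_energy_le_of_stabGram (hH : H.PosSemidef) (h : IsUnit (kkt H Q).det) (h' : IsUnit (kkt H' Q').det) (hcomp : Q' = Q * Qf)
    (hstab : ((1 + ε) • H' + δ • G - Qfᵀ * H * Qf).PosSemidef) (v : c → ℝ) :
    (Qf *ᵥ (minOp H' Q' *ᵥ v) - minOp H Q *ᵥ v) ⬝ᵥ (H *ᵥ (Qf *ᵥ (minOp H' Q' *ᵥ v) - minOp H Q *ᵥ v)) ≤
      (1 + ε) * (v ⬝ᵥ (effForm H' Q' *ᵥ v)) + δ * (v ⬝ᵥ (((minOp H' Q')ᵀ * G * minOp H' Q') *ᵥ v)) - v ⬝ᵥ (effForm H Q *ᵥ v) := by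
  rw [mismatch_energy_eq (transpose_eq_of_posSemidef hH) h h' hcomp v]
  set u' : ν' → ℝ := minOp H' Q' *ᵥ v with hu'
  have h2 := hstab.dotProduct_mulVec_nonneg u'
  simp only [star_trivial, sub_mulVec, add_mulVec, dotProduct_sub, dotProduct_add, sub_nonneg, smul_mulVec, dotProduct_smul,
    smul_eq_mul] at h2
  have e1 : (Qf *ᵥ u') ⬝ᵥ (H *ᵥ (Qf *ᵥ u')) = u' ⬝ᵥ ((Qfᵀ * H * Qf) *ᵥ u') := by
    rw [mulVec_dotProduct_eq, mulVec_mulVec, mulVec_mulVec, Matrix.mul_assoc]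
  have e2 : v ⬝ᵥ (effForm H' Q' *ᵥ v) = u' ⬝ᵥ (H' *ᵥ u') := by rw [hu']; exact dotProduct_effForm_eq_energy h' v
  have e3 : v ⬝ᵥ (((minOp H' Q')ᵀ * G * minOp H' Q') *ᵥ v) = u' ⬝ᵥ (G *ᵥ u') := by
    rw [hu', mulVec_dotProduct_eq, mulVec_mulVec, mulVec_mulVec, Matrix.mul_assoc]
  rw [e1, e2, e3]
  linarith

/-- **`mismatch_energy_le_of_stabGram_of_consForm` — THE SQUEEZE FOR ARBITRARY CONSTRAINT DATA** [our proof]: fine forms PSD, `Q′ = Q·Qf`, `Q′P = Q`,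
(STAB-ε,δ) (no sign condition on `ε, δ`) ⟹ for EVERY coarse datum `v` (not only unit sources): `⟨Qfℋ′v − ℋv, H(Qfℋ′v − ℋv)⟩ ≤ ε·⟨v,𝒮′v⟩ + δ·⟨v,(ℋ′ᵀGℋ′)v⟩ + ⟨ℋv, (PᵀH′P − H)ℋv⟩`
— R9°'s chain with `δ^M` = the (STAB) slack and `δ^ι` = the (CONS) FORM at the datum (the trial `Pℋv` is admissible one level up:
`⟨v,𝒮′v⟩ ≤ ⟨Pℋv, H′Pℋv⟩ = ⟨v,𝒮v⟩ + ⟨ℋv,(PᵀH′P − H)ℋv⟩`); the version a consumer applies to the block data `v = B` of the tower. -/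
theorem mismatch_energy_le_of_stabGram_of_consForm (hH : H.PosSemidef) (hH' : H'.PosSemidef) (h : IsUnit (kkt H Q).det)
    (h' : IsUnit (kkt H' Q').det) (hcomp : Q' = Q * Qf) (hPQ : Q' * P = Q)
    (hstab : ((1 + ε) • H' + δ • G - Qfᵀ * H * Qf).PosSemidef) (v : c → ℝ) :
    (Qf *ᵥ (minOp H' Q' *ᵥ v) - minOp H Q *ᵥ v) ⬝ᵥ (H *ᵥ (Qf *ᵥ (minOp H' Q' *ᵥ v) - minOp H Q *ᵥ v)) ≤
      ε * (v ⬝ᵥ (effForm H' Q' *ᵥ v)) + δ * (v ⬝ᵥ (((minOp H' Q')ᵀ * G * minOp H' Q') *ᵥ v)) +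
        (minOp H Q *ᵥ v) ⬝ᵥ ((Pᵀ * H' * P - H) *ᵥ (minOp H Q *ᵥ v)) := by
  have h1 := mismatch_energy_le_of_stabGram hH h h' hcomp hstab v
  set m : ν → ℝ := minOp H Q *ᵥ v with hm
  have hadm : Q' *ᵥ (P *ᵥ m) = v := by rw [mulVec_mulVec, hPQ, hm, mulVec_minOp h]
  have h2 := dotProduct_effForm_le_trial hH' h' hadm
  have h3 : (P *ᵥ m) ⬝ᵥ (H' *ᵥ (P *ᵥ m)) = m ⬝ᵥ ((Pᵀ * H' * P) *ᵥ m) := by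
    rw [mulVec_dotProduct_eq, mulVec_mulVec, mulVec_mulVec, Matrix.mul_assoc]
  have h4 : v ⬝ᵥ (effForm H Q *ᵥ v) = m ⬝ᵥ (H *ᵥ m) := by rw [hm]; exact dotProduct_effForm_eq_energy h v
  rw [sub_mulVec, dotProduct_sub]
  rw [h3] at h2
  nlinarith [h2, h4, h1]

/-- **`mismatch_energy_single_le_of_stabGram_of_cons` — THE RESTRICTION LEG OF A UNIT-SOURCE MINIMISER** [our proof]: with moreover `Q′P = Q`, (CONS ≤ κ) at
`y`, `|𝒮′_{ab}| ≤ B`, `|(ℋ′ᵀGℋ′)_{ab}| ≤ N`, `0 ≤ ε, δ`: `⟨Qfℋ′e_y − ℋe_y, H(Qfℋ′e_y − ℋe_y)⟩ ≤ κ + ε·B + δ·N` — the same scalar datum that bounds the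
effective-form step (PART 20) and the prolongation leg (PART 17 ∕ 20): `(𝒮′_{yy} − 𝒮_{yy}) ≤ (CONS)_y` is R9°'s `δ^ι`. -/
theorem mismatch_energy_single_le_of_stabGram_of_cons (hH : H.PosSemidef) (hH' : H'.PosSemidef) (h : IsUnit (kkt H Q).det)
    (h' : IsUnit (kkt H' Q').det) (hcomp : Q' = Q * Qf) (hPQ : Q' * P = Q) {κ B N : ℝ} (hε : 0 ≤ ε) (hδ : 0 ≤ δ)
    (hstab : ((1 + ε) • H' + δ • G - Qfᵀ * H * Qf).PosSemidef)
    (hcons : ∀ y, (minOp H Q *ᵥ Pi.single y 1) ⬝ᵥ ((Pᵀ * H' * P - H) *ᵥ (minOp H Q *ᵥ Pi.single y 1)) ≤ κ)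
    (hB : ∀ a b, |effForm H' Q' a b| ≤ B) (hN : ∀ a b, |((minOp H' Q')ᵀ * G * minOp H' Q') a b| ≤ N) (y : c) :
    (Qf *ᵥ (minOp H' Q' *ᵥ Pi.single y 1) - minOp H Q *ᵥ Pi.single y 1) ⬝ᵥ
        (H *ᵥ (Qf *ᵥ (minOp H' Q' *ᵥ Pi.single y 1) - minOp H Q *ᵥ Pi.single y 1)) ≤ κ + ε * B + δ * N := by
  have h1 := mismatch_energy_le_of_stabGram hH h h' hcomp hstab (Pi.single y 1)
  rw [single_dotProduct_mulVec_single, single_dotProduct_mulVec_single, single_dotProduct_mulVec_single] at h1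
  have hstep := effForm_step_diag_le_cons hH' h h' hPQ y
  have hy := (abs_le.mp (hB y y)).2
  have hMy := (abs_le.mp (hN y y)).2
  nlinarith [hcons y, mul_le_mul_of_nonneg_left hy hε, mul_le_mul_of_nonneg_left hMy hδ]

/-- the restriction leg is a FLUCTUATION: `Q(Qfℋ′v − ℋv) = 0`. [folklore] -/
theorem mismatch_mem_ker (h : IsUnit (kkt H Q).det) (h' : IsUnit (kkt H' Q').det) (hcomp : Q' = Q * Qf) (v : c → ℝ) :
    Q *ᵥ (Qf *ᵥ (minOp H' Q' *ᵥ v) - minOp H Q *ᵥ v) = 0 := by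
  rw [mulVec_sub, mismatch_admissible h' hcomp v, mulVec_minOp h v, sub_self]

/-- **`mismatch_sq_le_of_coercive` — FROM ENERGY TO `ℓ²` MASS ON THE CONSTRAINT KERNEL** [our proof]: if the coarse form is COERCIVE ON FLUCTUATIONS,
`Qz = 0 → γ·⟨z,z⟩ ≤ ⟨z,Hz⟩` with `0 < γ` (Bałaban's `Δ_a = ∂*∂ + ∂R∂* + aQ*Q`-type positivity on `ker Q`), then under the hypotheses of
`mismatch_energy_single_le_of_stabGram_of_cons` the restriction leg has `ℓ²` mass `⟨m,m⟩ ≤ (κ + εB + δN)∕γ`, `m = Qfℋ′e_y − ℋe_y` — the squared-mismatch MASS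
letter of the «R9° notes» (S1-B's output) in the matrix currency, GLOBAL (one unit source), with the bootstrap caveat of the file header. -/
theorem mismatch_sq_le_of_coercive (hH : H.PosSemidef) (hH' : H'.PosSemidef) (h : IsUnit (kkt H Q).det)
    (h' : IsUnit (kkt H' Q').det) (hcomp : Q' = Q * Qf) (hPQ : Q' * P = Q) {κ B N γ : ℝ} (hε : 0 ≤ ε) (hδ : 0 ≤ δ) (hγ : 0 < γ)
    (hcoer : ∀ z : ν → ℝ, Q *ᵥ z = 0 → γ * (z ⬝ᵥ z) ≤ z ⬝ᵥ (H *ᵥ z))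
    (hstab : ((1 + ε) • H' + δ • G - Qfᵀ * H * Qf).PosSemidef)
    (hcons : ∀ y, (minOp H Q *ᵥ Pi.single y 1) ⬝ᵥ ((Pᵀ * H' * P - H) *ᵥ (minOp H Q *ᵥ Pi.single y 1)) ≤ κ)
    (hB : ∀ a b, |effForm H' Q' a b| ≤ B) (hN : ∀ a b, |((minOp H' Q')ᵀ * G * minOp H' Q') a b| ≤ N) (y : c) :
    (Qf *ᵥ (minOp H' Q' *ᵥ Pi.single y 1) - minOp H Q *ᵥ Pi.single y 1) ⬝ᵥ
        (Qf *ᵥ (minOp H' Q' *ᵥ Pi.single y 1) - minOp H Q *ᵥ Pi.single y 1) ≤ (κ + ε * B + δ * N) / γ := by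
  rw [le_div_iff₀ hγ, mul_comm]
  exact (hcoer _ (mismatch_mem_ker h h' hcomp _)).trans
    (mismatch_energy_single_le_of_stabGram_of_cons hH hH' h h' hcomp hPQ hε hδ hstab hcons hB hN y)

end TwoLevels

/-! ## §2 Along the tower: PART 20's slacks, PART 88's scheduled family -/

section Tower

variable {c : Type*} [Fintype c] [DecidableEq c]
variable {ι : ℕ → Type*} [∀ j, Fintype (ι j)] [∀ j, DecidableEq (ι j)]
variable {H : ∀ j, Matrix (ι j) (ι j) ℝ} {Qf : ∀ j, Matrix (ι j) (ι (j + 1)) ℝ} {Qc : ∀ j, Matrix c (ι j) ℝ}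
variable {P : ∀ j, Matrix (ι (j + 1)) (ι j) ℝ} {G : ∀ j, Matrix (ι j) (ι j) ℝ} {e τ : ℕ → ℝ} {cst cε cδ B N E₀ M₀ N₀ Λ θ θp θm : ℝ}

/-- **`mismatch_energy_step_rate_of_stabGram_of_cons` — THE RESTRICTION LEGS DECAY AT THE END's RATE (PART 20's letters)** [our proof]: PSD fine forms,
nonsingular bordered matrices, `Qc (j+1) = Qc j·Qf j`, `Qc (j+1)·P j = Qc j`, (STAB-ε_j,δ_j) with `ε_j = cε·θ^j`, `δ_j = cδ·θ^j`, (CONS) `≤ cst·θ^j`, k-uniform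
`B`, `N` (`0 ≤ cε, cδ, θ`) ⟹ `∀ j y, ⟨Qf_jℋ_{j+1}e_y − ℋ_je_y, H_j(Qf_jℋ_{j+1}e_y − ℋ_je_y)⟩ ≤ (cst + cε·B + cδ·N)·θ^j`. -/
theorem mismatch_energy_step_rate_of_stabGram_of_cons (hH : ∀ j, (H j).PosSemidef) (hk : ∀ j, IsUnit (kkt (H j) (Qc j)).det)
    (hcomp : ∀ j, Qc (j + 1) = Qc j * Qf j) (hPQ : ∀ j, Qc (j + 1) * P j = Qc j)
    (hcε : 0 ≤ cε) (hcδ : 0 ≤ cδ) (hθ0 : 0 ≤ θ)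
    (hstab : ∀ j, ((1 + cε * θ ^ j) • H (j + 1) + (cδ * θ ^ j) • G (j + 1) - (Qf j)ᵀ * H j * Qf j).PosSemidef)
    (hcons : ∀ j (y : c), (minOp (H j) (Qc j) *ᵥ Pi.single y 1) ⬝ᵥ
        (((P j)ᵀ * H (j + 1) * P j - H j) *ᵥ (minOp (H j) (Qc j) *ᵥ Pi.single y 1)) ≤ cst * θ ^ j)
    (hB : ∀ j a b, |effForm (H j) (Qc j) a b| ≤ B) (hN : ∀ j a b, |((minOp (H j) (Qc j))ᵀ * G j * minOp (H j) (Qc j)) a b| ≤ N) :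
    ∀ j (y : c), (Qf j *ᵥ (minOp (H (j + 1)) (Qc (j + 1)) *ᵥ Pi.single y 1) - minOp (H j) (Qc j) *ᵥ Pi.single y 1) ⬝ᵥ
        (H j *ᵥ (Qf j *ᵥ (minOp (H (j + 1)) (Qc (j + 1)) *ᵥ Pi.single y 1) - minOp (H j) (Qc j) *ᵥ Pi.single y 1)) ≤
      (cst + cε * B + cδ * N) * θ ^ j := by
  intro j y
  have hθj : 0 ≤ θ ^ j := pow_nonneg hθ0 j
  have h := mismatch_energy_single_le_of_stabGram_of_cons (hH j) (hH (j + 1)) (hk j) (hk (j + 1)) (hcomp j) (hPQ j)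
    (mul_nonneg hcε hθj) (mul_nonneg hcδ hθj) (hstab j) (hcons j) (fun a b => hB (j + 1) a b) (fun a b => hN (j + 1) a b) y
  refine h.trans (le_of_eq ?_)
  ring

/-- **`mismatch_energy_rate_of_stabFamily_of_schedules` — THE RESTRICTION LEGS UNDER PART 88's SCHEDULED FAMILY** [our proof]: PART 88's hypotheses
(`hH hk hcomp hPQ`, the family `∀ s > 0, 0 ≤ ((1+s)(1+e_j))•H_{j+1} + ((1+s⁻¹)τ_j²)•G_{j+1} − Qf_jᵀH_jQf_j`, (CONS), `hB`, schedules `e_j ≤ E₀θ_p^j`,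
`τ_j ≤ M₀θ_m^j`, growth `N₀Λ^j`, `0 < θ ≤ 1`, `0 ≤ θ_p ≤ θ`, `0 ≤ E₀, N₀, Λ`, `hrate : θ_m²Λ ≤ θ²`) ⟹
`∀ j y, ⟨Qf_jℋ_{j+1}e_y − ℋ_je_y, H_j(…)⟩ ≤ (cst + (1 + 2E₀)·B + 2·M₀²N₀Λ)·θ^j` (bootstrap shape: `τ_j` enters at second order). -/
theorem mismatch_energy_rate_of_stabFamily_of_schedules (hH : ∀ j, (H j).PosSemidef) (hk : ∀ j, IsUnit (kkt (H j) (Qc j)).det)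
    (hcomp : ∀ j, Qc (j + 1) = Qc j * Qf j) (hPQ : ∀ j, Qc (j + 1) * P j = Qc j)
    (hstab : ∀ j (s : ℝ), 0 < s →
      ((((1 + s) * (1 + e j)) • H (j + 1) + ((1 + s⁻¹) * τ j ^ 2) • G (j + 1) - (Qf j)ᵀ * H j * Qf j).PosSemidef))
    (hcons : ∀ j (y : c), (minOp (H j) (Qc j) *ᵥ Pi.single y 1) ⬝ᵥ
        (((P j)ᵀ * H (j + 1) * P j - H j) *ᵥ (minOp (H j) (Qc j) *ᵥ Pi.single y 1)) ≤ cst * θ ^ j)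
    (hB : ∀ j a b, |effForm (H j) (Qc j) a b| ≤ B)
    (he : ∀ j, 0 ≤ e j ∧ e j ≤ E₀ * θp ^ j) (hτ : ∀ j, 0 ≤ τ j ∧ τ j ≤ M₀ * θm ^ j)
    (hN : ∀ j a b, |((minOp (H j) (Qc j))ᵀ * G j * minOp (H j) (Qc j)) a b| ≤ N₀ * Λ ^ j)
    (hθ : 0 < θ) (hθ1 : θ ≤ 1) (hθp : 0 ≤ θp) (hθpθ : θp ≤ θ) (hE₀ : 0 ≤ E₀) (hN₀ : 0 ≤ N₀) (hΛ : 0 ≤ Λ)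
    (hrate : θm ^ 2 * Λ ≤ θ ^ 2) :
    ∀ j (y : c), (Qf j *ᵥ (minOp (H (j + 1)) (Qc (j + 1)) *ᵥ Pi.single y 1) - minOp (H j) (Qc j) *ᵥ Pi.single y 1) ⬝ᵥ
        (H j *ᵥ (Qf j *ᵥ (minOp (H (j + 1)) (Qc (j + 1)) *ᵥ Pi.single y 1) - minOp (H j) (Qc j) *ᵥ Pi.single y 1)) ≤
      (cst + (1 + 2 * E₀) * B + 2 * (M₀ ^ 2 * N₀ * Λ)) * θ ^ j := by
  intro j y
  have hθj : 0 < θ ^ j := pow_pos hθ j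
  have hB0 : 0 ≤ B := (abs_nonneg _).trans (hB j y y)
  have hε : 0 ≤ (1 + θ ^ j) * (1 + e j) - 1 := by nlinarith [(he j).1, hθj.le]
  have hδ : 0 ≤ (1 + (θ ^ j)⁻¹) * τ j ^ 2 := by positivity
  have hstab' : ((1 + ((1 + θ ^ j) * (1 + e j) - 1)) • H (j + 1) + ((1 + (θ ^ j)⁻¹) * τ j ^ 2) • G (j + 1) -
      (Qf j)ᵀ * H j * Qf j).PosSemidef := by
    have e1 : (1 + ((1 + θ ^ j) * (1 + e j) - 1)) = (1 + θ ^ j) * (1 + e j) := by ring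
    rw [e1]; exact hstab j (θ ^ j) hθj
  have h := mismatch_energy_single_le_of_stabGram_of_cons (hH j) (hH (j + 1)) (hk j) (hk (j + 1)) (hcomp j) (hPQ j) hε hδ hstab'
    (hcons j) (fun a b => hB (j + 1) a b) (fun a b => hN (j + 1) a b) y
  have hmul : ((1 + θ ^ j) * (1 + e j) - 1) * B ≤ (1 + 2 * E₀) * B * θ ^ j := by
    have := mul_le_mul_of_nonneg_right (mulSlack_le hθ hθ1 hθp hθpθ hE₀ (he j).1 (he j).2) hB0
    nlinarith
  have hadd : ((1 + (θ ^ j)⁻¹) * τ j ^ 2) * (N₀ * Λ ^ (j + 1)) ≤ 2 * (M₀ ^ 2 * N₀ * Λ) * θ ^ j := by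
    have hτ2 : τ j ^ 2 ≤ (M₀ * θm ^ j) ^ 2 := pow_le_pow_left₀ (hτ j).1 (hτ j).2 2
    have hs' : 0 ≤ 1 + (θ ^ j)⁻¹ := by positivity
    have hNΛ : 0 ≤ N₀ * Λ ^ (j + 1) := by positivity
    have h1 : (1 + (θ ^ j)⁻¹) * τ j ^ 2 * (N₀ * Λ ^ (j + 1)) ≤ (1 + (θ ^ j)⁻¹) * (M₀ * θm ^ j) ^ 2 * (N₀ * Λ ^ (j + 1)) :=
      mul_le_mul_of_nonneg_right (mul_le_mul_of_nonneg_left hτ2 hs') hNΛ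
    have h2 := addSlack_le (M₀ := M₀) (N₀ := N₀) (j := j) hθ hθ1 hΛ hN₀ hrate
    nlinarith
  calc _ ≤ cst * θ ^ j + ((1 + θ ^ j) * (1 + e j) - 1) * B + ((1 + (θ ^ j)⁻¹) * τ j ^ 2) * (N₀ * Λ ^ (j + 1)) := h
    _ ≤ cst * θ ^ j + (1 + 2 * E₀) * B * θ ^ j + 2 * (M₀ ^ 2 * N₀ * Λ) * θ ^ j := by linarith
    _ = (cst + (1 + 2 * E₀) * B + 2 * (M₀ ^ 2 * N₀ * Λ)) * θ ^ j := by ring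

end Tower

end Summit.QuantumFields.BalabanUV.Beta.GAN24.DerivativeRateTransferLoewnerGramMismatch

end
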